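import Summits.QuantumFields.BalabanUV.Beta.GAN24.TaylorRowVSupport
import Summits.QuantumFields.BalabanUV.Beta.GAN24.TaylorMassVHSymAn1At

/-!
# Road «S3-Taylor», V row support lemma for an1's SYMMETRISED border (twin of `TaylorRowVSupportSymAt`)

NOT IN PRINT — OUR BOOKKEEPING (road-P2 = `b2b-balaban-gan24-p2` gen 56, 2026-08-25; row G-an2-4 ∕ (CONV-C), the (α-0) chain at row D1's literal
OF RECORD (III′) `JsB12CombShSym`; [folklore] composition BY NAME; 0 `def`, 0 cite, 0 `def … : Prop`, 0 `sorry`).  Weight 0.  NEVER «G-an2-4 closed» as (CONV-C);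
NOT D1, NOT BetaPertH, NOT continuum, NOT Clay; NO campaign opened (an2 W-4) — a brick of the located `hUv⁰` transfer (road-P2 MEMO M-gan24p2-g56-1 §2(b) with M.77's
RAW-table socket `CombBornBorderLettersRaw`).

NAMING: in this package «Sym» in the ROOTED file names (`…SymAt`) means the UN-NEGATED rooted border `vhSAt ρ` (the OWNER's W15), while «An1» (these files) means an1's
(0.4)-SYMMETRISED border table `SymAveragingHessianCounts.symVhSAt ρ` — the type of the record field `SymTables.V`.  METHOD = the OWNER gan24-p1's gen-6 `mkroot.py` rule
(road-P2's `tools/mkstab.py`): the ROOTED file VERBATIM with `vhSAt (toSite r) ↦ symVhSAt (toSite r)`, asym's `SpineRooted.borderIncAt ↦ TaylorMassVHAn1At.symBorderIncAt`, an1's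
rooted support ∕ entry ∕ locality lemmas ↦ his SYMMETRISED ones (`symVhKerAt_eq_zero_left ∕ _right`, `abs_symVhKerAt_le ≤ 3ℓ²` «the SAME constant as the comb's», `locStencil_symVhSAt`,
block accessors by `packVH`); every ROOT-FREE lemma of the base modules BY NAME (not re-declared); same theorem names in the `…An1At` namespaces; base and rooted modules untouched;
zero-root bridges dropped (no root-0 base twin for the sym table).  Discharges NOTHING of (hS, hSall) ∕ hB by itself.
-/

noncomputable section

open Finset
open scoped BigOperators
open Literature.MathematicalPhysics.QuantumFieldTheory
open Literature.MathematicalPhysics.QuantumFieldTheory.Balaban1983to89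
open Literature.MathematicalPhysics.QuantumFieldTheory.Balaban1983to89.Beta
open Literature.Probability.LatticeModels (Torus.proj)
open LatticeForm (quo)
open B12Sec2to5 (l1 l1_nonneg)
open ExpKernelCalculus (MKer l1_natSmul l1_sub_triangle l1_sub_symm)
open OneStepResolventKernel (Fib eq_zsmul_quo_of_proj quo_zsmul proj_zsmul)
open OneStepKernelFamily (LegIdx legPt)
open AffineAveraging (box toSite)
open BalabanCompositeJets (pushSum)
open DecLiftAdjoint (borderSum)
open Summit.QuantumFields.BalabanUV.Beta.SymAveragingHessianCounts (symVhSAt symVhKerAt symVhKerAt_eq_zero_left symVhKerAt_eq_zero_right abs_symVhKerAt_le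
  locStencil_symVhSAt symVhSAt_symm)
open Summit.QuantumFields.BalabanUV.Beta.GAN24.PushSumNest (pushSum_inr_of_proj_ne)
open Summit.QuantumFields.BalabanUV.Beta.GAN24.TaylorMassVHSymAn1At (borderSumV_ne_zero)
open Summit.QuantumFields.BalabanUV.Beta.GAN24.TaylorMassVHPush (pushSum_inr_inl_coarse_sum)

namespace Summit.QuantumFields.BalabanUV.Beta.GAN24.TaylorRowVSupportSymAn1At

variable {d : ℕ} {Lc : ℕ} [NeZero Lc]

/-- [folklore] **SUPPORT OF THE PUSHED INCREMENT, (multiplier, field) block** (the twin of VH1's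
`TaylorMassVHAn1At.pushSum_borderSumV_inl_inr_ne_zero`, ROOTED, box root): a nonzero entry has its multiplier leg (first site, a point of the new coarse lattice)
within `R_V·M + 2(d+1)·L·(M·Lc)` of the fine bond `u` and its field leg (second site) within `R_V·M`. -/
theorem pushSum_borderSumV_inr_inl_ne_zero (M L : ℕ) [NeZero M] [NeZero L] (hL : 1 ≤ Lc) {r : Fin (d + 1) → ℕ} (hr : r ∈ box (d + 1) Lc)
    {κ : Fin (d + 1)}
    {u x y : Fin (d + 1) → ℤ} {μ α : Fin (d + 1)}
    (h : pushSum (M * Lc) L (borderSum M (fun κ₀ z₀ => symVhSAt (toSite r) d Lc rfl κ₀ z₀) κ u) x y (Sum.inr μ) (Sum.inl α) ≠ 0) :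
    l1 (x - u) ≤ ((2 * (d + 1) * (Lc + 1) + (2 * d + 3)) * M : ℕ) + 2 * ((d : ℝ) + 1) * L * (M * Lc : ℕ) ∧
      l1 (y - u) ≤ ((2 * (d + 1) * (Lc + 1) + (2 * d + 3)) * M : ℕ) := by
  have hproj : Torus.proj (M * Lc * L) x = 0 := by
    by_contra hne; exact h (pushSum_inr_of_proj_ne (M * Lc) L hne _ y μ _)
  have ex := eq_zsmul_quo_of_proj (N := M * Lc * L) hproj
  rw [ex, pushSum_inr_inl_coarse_sum] at h
  obtain ⟨i', hi', hne⟩ := Finset.exists_ne_zero_of_sum_ne_zero h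
  obtain ⟨hx, hy⟩ := borderSumV_ne_zero M hL hr hne
  refine ⟨?_, hy⟩
  set W' := quo (M * Lc * L) x with hW'
  have hoff : l1 (legPt L (Sum.inl μ : Fib d) W' i' - (L : ℤ) • W') ≤ 2 * (d + 1) * L :=
    OneStepKernelFamily.l1_legPt_sub_le L (Sum.inl μ : Fib d) W' hi'
  have e1 : (((M * Lc * L : ℕ) : ℤ)) • W' = ((M * Lc : ℕ) : ℤ) • ((L : ℤ) • W') := by rw [smul_smul]; push_cast; ring_nf
  have hdist : l1 ((((M * Lc * L : ℕ) : ℤ)) • W' - ((M * Lc : ℕ) : ℤ) • legPt L (Sum.inl μ : Fib d) W' i') ≤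
      2 * ((d : ℝ) + 1) * L * (M * Lc : ℕ) := by
    rw [e1, ← smul_sub, l1_natSmul, l1_sub_symm]
    have hMLc : (0 : ℝ) ≤ (M * Lc : ℕ) := Nat.cast_nonneg _
    calc ((M * Lc : ℕ) : ℝ) * l1 (legPt L (Sum.inl μ : Fib d) W' i' - (L : ℤ) • W') ≤ ((M * Lc : ℕ) : ℝ) * (2 * (d + 1) * L) :=
          mul_le_mul_of_nonneg_left hoff hMLc
      _ = 2 * ((d : ℝ) + 1) * L * (M * Lc : ℕ) := by ring
  rw [← ex] at hdist
  have tri := l1_sub_triangle x (((M * Lc : ℕ) : ℤ) • legPt L (Sum.inl μ : Fib d) W' i') u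
  linarith

end Summit.QuantumFields.BalabanUV.Beta.GAN24.TaylorRowVSupportSymAn1At

end
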